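import Summits.FinalStateConjecture.FinalStateConjecture.Theorems.PhotonSphereChannelsEnergyIdentity

/-!
# Route EIHFluxBalance — `RecedingWellsEnergyBound`: a Green identity on trapezoids with a source term

First helper file for the support item stmt-FinalStateConjecture-10168
(`Summit.FinalStateConjecture.FinalStateConjecture.Theses.EIHFluxBalance.RecedingWellsEnergyBound`,
the 1+1 toy `u_tt − u_xx + (V(x − vt) + V(x + vt)) u = 0` of the modulated-energy layer).

The energy–flux calculus of route PhotonSphereChannels (`WaveEnergy.energy_identity_affine`) treats
the divergence-FREE pair `(e, −m)` of a static potential.  For a time-dependent potential, and for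
the weighted/multiplier energies used to bound the energy of the receding-wells toy, the relevant
pairs `(q, g)` have a non-zero but SIGNED divergence `∂ₜ q + ∂ₓ g = d`.  This file proves the
corresponding Green identity on a trapezoid with affinely moving ends `α(t) = a₀ + a₁ t`,
`β(t) = b₀ + b₁ t` (`trapezoid_identity`):

  `∫_{α t₂}^{β t₂} q(t₂,·) − ∫_{α t₁}^{β t₁} q(t₁,·)
      = ∫_{t₁}^{t₂} [(b₁ q − g)(t, β t) − (a₁ q − g)(t, α t)] dt + ∫_{t₁}^{t₂} ∫_{α t}^{β t} d(t, x) dx dt`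

for differentiable `q g : ℝ × ℝ → ℝ` and continuous `d` (pull-back of the trapezoid to the box
`[t₁, t₂] × [0, 1]` and Mathlib's `integral2_divergence_prod_of_hasFDerivAt`, exactly as in
`energy_identity_affine`), and its two monotonicity corollaries: `trapezoid_le` (`d ≤ 0` on the
trapezoid, `t₁ ≤ t₂`, `α ≤ β`) and the fixed-ends form `integral_rect_le` (equal fluxes through
`x = ±L`).  No definitions; standard material [folklore].
-/

namespace Summit.FinalStateConjecture.FinalStateConjecture.Theorems

open MeasureTheory Set Filter Topology intervalIntegral

noncomputable section

namespace MovingWells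

open WaveEnergy

/-- **Green identity on a trapezoid with source.** For differentiable `q g : ℝ × ℝ → ℝ` with
`∂ₜ q + ∂ₓ g = d` pointwise (`d` continuous) and affinely moving ends `α(t) = a₀ + a₁ t`,
`β(t) = b₀ + b₁ t`:
`∫_{α t₂}^{β t₂} q(t₂,·) − ∫_{α t₁}^{β t₁} q(t₁,·) = ∫_{t₁}^{t₂} [(b₁ q − g)(t, β t) − (a₁ q − g)(t, α t)] dt
  + ∫_{t₁}^{t₂} ∫_{α t}^{β t} d(t,x) dx dt` (oriented integrals, no ordering hypotheses). [folklore] -/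
theorem trapezoid_identity {q g d : ℝ × ℝ → ℝ} (hq : Differentiable ℝ q) (hg : Differentiable ℝ g)
    (hd : Continuous d) (hdiv : ∀ z, fderiv ℝ q z (1, 0) + fderiv ℝ g z (0, 1) = d z)
    (a₀ a₁ b₀ b₁ t₁ t₂ : ℝ) :
    (∫ x in (a₀ + a₁ * t₂)..(b₀ + b₁ * t₂), q (t₂, x))
        - ∫ x in (a₀ + a₁ * t₁)..(b₀ + b₁ * t₁), q (t₁, x)
      = (∫ t in t₁..t₂, ((b₁ * q (t, b₀ + b₁ * t) - g (t, b₀ + b₁ * t))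
          - (a₁ * q (t, a₀ + a₁ * t) - g (t, a₀ + a₁ * t))))
        + ∫ t in t₁..t₂, ∫ x in (a₀ + a₁ * t)..(b₀ + b₁ * t), d (t, x) := by
  have hqc := hq.continuous
  have hgc := hg.continuous
  -- the pulled-back pair on the box `[t₁, t₂] × [0, 1]`
  set F : ℝ × ℝ → ℝ := fun p =>
    (b₀ + b₁ * p.1 - (a₀ + a₁ * p.1)) * q (p.1, (b₀ + b₁ * p.1 - (a₀ + a₁ * p.1)) * p.2
      + (a₀ + a₁ * p.1)) with hF
  set G : ℝ × ℝ → ℝ := fun p =>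
    g (p.1, (b₀ + b₁ * p.1 - (a₀ + a₁ * p.1)) * p.2 + (a₀ + a₁ * p.1))
      - (a₁ + (b₁ - a₁) * p.2) * q (p.1, (b₀ + b₁ * p.1 - (a₀ + a₁ * p.1)) * p.2
        + (a₀ + a₁ * p.1)) with hG
  have hFd : Differentiable ℝ F := by
    simp only [hF]
    fun_prop
  have hGd : Differentiable ℝ G := by
    simp only [hG]
    fun_prop
  -- divergence of `(F, G)` is the pulled-back source
  have hdiv' : ∀ t θ : ℝ, fderiv ℝ F (t, θ) (1, 0) + fderiv ℝ G (t, θ) (0, 1)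
      = (b₀ + b₁ * t - (a₀ + a₁ * t))
        * d (t, (b₀ + b₁ * t - (a₀ + a₁ * t)) * θ + (a₀ + a₁ * t)) := by
    intro t θ
    have haff : ∀ (p r s : ℝ), HasDerivAt (fun τ : ℝ => p + r * τ) r s := fun p r s => by
      simpa using ((hasDerivAt_id s).const_mul r).const_add p
    have hL : HasDerivAt (fun τ : ℝ => b₀ + b₁ * τ - (a₀ + a₁ * τ)) (b₁ - a₁) t :=
      (haff b₀ b₁ t).fun_sub (haff a₀ a₁ t)
    have hX : HasDerivAt (fun τ : ℝ => (b₀ + b₁ * τ - (a₀ + a₁ * τ)) * θ + (a₀ + a₁ * τ))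
        ((b₁ - a₁) * θ + a₁) t :=
      (hL.mul_const θ).fun_add (haff a₀ a₁ t)
    have hγ : HasDerivAt (fun τ : ℝ => (τ, (b₀ + b₁ * τ - (a₀ + a₁ * τ)) * θ + (a₀ + a₁ * τ)))
        ((1 : ℝ), (b₁ - a₁) * θ + a₁) t := (hasDerivAt_id' t).prodMk hX
    have hY : HasDerivAt (fun θ' : ℝ => (b₀ + b₁ * t - (a₀ + a₁ * t)) * θ' + (a₀ + a₁ * t))
        (b₀ + b₁ * t - (a₀ + a₁ * t)) θ := by
      simpa using ((hasDerivAt_id θ).const_mul (b₀ + b₁ * t - (a₀ + a₁ * t))).add_const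
        (a₀ + a₁ * t)
    have hδ : HasDerivAt (fun θ' : ℝ => (t, (b₀ + b₁ * t - (a₀ + a₁ * t)) * θ' + (a₀ + a₁ * t)))
        ((0 : ℝ), (b₀ + b₁ * t - (a₀ + a₁ * t))) θ := (hasDerivAt_const θ t).prodMk hY
    have hcoef : HasDerivAt (fun θ' : ℝ => a₁ + (b₁ - a₁) * θ') (b₁ - a₁) θ := haff a₁ (b₁ - a₁) θ
    set Xv : ℝ := (b₀ + b₁ * t - (a₀ + a₁ * t)) * θ + (a₀ + a₁ * t) with hXv
    have hFs : HasDerivAt (fun τ => F (τ, θ))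
        ((b₁ - a₁) * q (t, Xv) + (b₀ + b₁ * t - (a₀ + a₁ * t))
          * fderiv ℝ q (t, Xv) ((1 : ℝ), (b₁ - a₁) * θ + a₁)) t := by
      have h := hL.fun_mul (hasDerivAt_comp_curve hq hγ)
      exact h
    have hGs : HasDerivAt (fun θ' => G (t, θ'))
        (fderiv ℝ g (t, Xv) ((0 : ℝ), (b₀ + b₁ * t - (a₀ + a₁ * t)))
          - ((b₁ - a₁) * q (t, Xv)
            + (a₁ + (b₁ - a₁) * θ)
              * fderiv ℝ q (t, Xv) ((0 : ℝ), (b₀ + b₁ * t - (a₀ + a₁ * t))))) θ := by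
      have h := (hasDerivAt_comp_curve hg hδ).fun_sub
        (hcoef.fun_mul (hasDerivAt_comp_curve hq hδ))
      exact h
    have h1 := (hasDerivAt_slice_fst hFd t θ).unique hFs
    have h2 := (hasDerivAt_slice_snd hGd t θ).unique hGs
    rw [h1, h2, clm_apply_one_snd (fderiv ℝ q (t, Xv)) ((b₁ - a₁) * θ + a₁),
      clm_apply_zero_snd (fderiv ℝ g (t, Xv)) (b₀ + b₁ * t - (a₀ + a₁ * t)),
      clm_apply_zero_snd (fderiv ℝ q (t, Xv)) (b₀ + b₁ * t - (a₀ + a₁ * t)), ← hdiv (t, Xv)]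
    ring
  -- the pulled-back source is continuous, hence integrable on the box
  have hsrc : Continuous fun z : ℝ × ℝ => (b₀ + b₁ * z.1 - (a₀ + a₁ * z.1))
      * d (z.1, (b₀ + b₁ * z.1 - (a₀ + a₁ * z.1)) * z.2 + (a₀ + a₁ * z.1)) := by
    fun_prop
  -- Green's formula on the box
  have key := integral2_divergence_prod_of_hasFDerivAt F G (fderiv ℝ F) (fderiv ℝ G) t₁ 0 t₂ 1
    hFd.continuous.continuousOn hGd.continuous.continuousOn
    (fun z _ => (hFd z).hasFDerivAt) (fun z _ => (hGd z).hasFDerivAt)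
    (by
      have : (fun z : ℝ × ℝ => fderiv ℝ F z (1, 0) + fderiv ℝ G z (0, 1))
          = fun z : ℝ × ℝ => (b₀ + b₁ * z.1 - (a₀ + a₁ * z.1))
            * d (z.1, (b₀ + b₁ * z.1 - (a₀ + a₁ * z.1)) * z.2 + (a₀ + a₁ * z.1)) :=
        funext fun z => hdiv' z.1 z.2
      rw [this]
      exact hsrc.continuousOn.integrableOn_compact (isCompact_uIcc.prod isCompact_uIcc))
  have hlhs : (∫ t in t₁..t₂, ∫ θ in (0 : ℝ)..1,
      fderiv ℝ F (t, θ) (1, 0) + fderiv ℝ G (t, θ) (0, 1))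
      = ∫ t in t₁..t₂, ∫ x in (a₀ + a₁ * t)..(b₀ + b₁ * t), d (t, x) := by
    simp_rw [hdiv']
    refine intervalIntegral.integral_congr fun t _ => ?_
    rw [intervalIntegral.integral_const_mul,
      intervalIntegral.mul_integral_comp_mul_add (f := fun x => d (t, x))]
    congr 1 <;> ring
  rw [hlhs] at key
  -- evaluate the four boundary terms
  have hG1 : ∀ t, G (t, 1) = g (t, b₀ + b₁ * t) - b₁ * q (t, b₀ + b₁ * t) := by
    intro t
    have h1 : (b₀ + b₁ * t - (a₀ + a₁ * t)) * 1 + (a₀ + a₁ * t) = b₀ + b₁ * t := by ring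
    have h2 : a₁ + (b₁ - a₁) * 1 = b₁ := by ring
    simp only [hG, h1, h2]
  have hG0 : ∀ t, G (t, 0) = g (t, a₀ + a₁ * t) - a₁ * q (t, a₀ + a₁ * t) := by
    intro t
    have h1 : (b₀ + b₁ * t - (a₀ + a₁ * t)) * 0 + (a₀ + a₁ * t) = a₀ + a₁ * t := by ring
    have h2 : a₁ + (b₁ - a₁) * 0 = a₁ := by ring
    simp only [hG, h1, h2]
  have hFint : ∀ t, (∫ θ in (0 : ℝ)..1, F (t, θ))
      = ∫ x in (a₀ + a₁ * t)..(b₀ + b₁ * t), q (t, x) := by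
    intro t
    simp only [hF]
    rw [intervalIntegral.integral_const_mul,
      intervalIntegral.mul_integral_comp_mul_add (f := fun x => q (t, x))]
    congr 1 <;> ring
  rw [hFint, hFint] at key
  simp_rw [hG1, hG0] at key
  have hi1 : IntervalIntegrable (fun t => g (t, b₀ + b₁ * t) - b₁ * q (t, b₀ + b₁ * t))
      volume t₁ t₂ := by
    apply Continuous.intervalIntegrable
    fun_prop
  have hi0 : IntervalIntegrable (fun t => g (t, a₀ + a₁ * t) - a₁ * q (t, a₀ + a₁ * t))
      volume t₁ t₂ := by
    apply Continuous.intervalIntegrable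
    fun_prop
  have hsub := intervalIntegral.integral_sub hi0 hi1
  have hcongr : (∫ t in t₁..t₂, ((b₁ * q (t, b₀ + b₁ * t) - g (t, b₀ + b₁ * t))
      - (a₁ * q (t, a₀ + a₁ * t) - g (t, a₀ + a₁ * t))))
      = ∫ t in t₁..t₂, ((g (t, a₀ + a₁ * t) - a₁ * q (t, a₀ + a₁ * t))
        - (g (t, b₀ + b₁ * t) - b₁ * q (t, b₀ + b₁ * t))) := by
    congr 1
    funext t
    ring
  rw [hcongr, hsub]
  linarith

/-- An interval integral of a function that is non-positive on the (ordered) interval is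
non-positive. -/
theorem intervalIntegral_nonpos_of_le {f : ℝ → ℝ} {a b : ℝ} (hab : a ≤ b)
    (hf : ∀ x ∈ Icc a b, f x ≤ 0) : (∫ x in a..b, f x) ≤ 0 := by
  have h : 0 ≤ ∫ x in a..b, -f x :=
    intervalIntegral.integral_nonneg hab fun x hx => neg_nonneg.mpr (hf x hx)
  rw [intervalIntegral.integral_neg] at h
  linarith

/-- **Monotonicity on a trapezoid.** Under the hypotheses of `trapezoid_identity`, if `t₁ ≤ t₂`,
the ends are ordered (`α ≤ β` on `[t₁, t₂]`) and the source is non-positive on the trapezoid, then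
`∫_{α t₂}^{β t₂} q(t₂,·) − ∫_{α t₁}^{β t₁} q(t₁,·) ≤ ∫_{t₁}^{t₂} [(b₁ q − g)(t, β t) − (a₁ q − g)(t, α t)] dt`.
[folklore] -/
theorem trapezoid_le {q g d : ℝ × ℝ → ℝ} (hq : Differentiable ℝ q) (hg : Differentiable ℝ g)
    (hd : Continuous d) (hdiv : ∀ z, fderiv ℝ q z (1, 0) + fderiv ℝ g z (0, 1) = d z)
    (a₀ a₁ b₀ b₁ : ℝ) {t₁ t₂ : ℝ} (ht : t₁ ≤ t₂)
    (hαβ : ∀ t ∈ Icc t₁ t₂, a₀ + a₁ * t ≤ b₀ + b₁ * t)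
    (hneg : ∀ t ∈ Icc t₁ t₂, ∀ x ∈ Icc (a₀ + a₁ * t) (b₀ + b₁ * t), d (t, x) ≤ 0) :
    (∫ x in (a₀ + a₁ * t₂)..(b₀ + b₁ * t₂), q (t₂, x))
        - ∫ x in (a₀ + a₁ * t₁)..(b₀ + b₁ * t₁), q (t₁, x)
      ≤ ∫ t in t₁..t₂, ((b₁ * q (t, b₀ + b₁ * t) - g (t, b₀ + b₁ * t))
          - (a₁ * q (t, a₀ + a₁ * t) - g (t, a₀ + a₁ * t))) := by
  rw [trapezoid_identity hq hg hd hdiv a₀ a₁ b₀ b₁ t₁ t₂]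
  have h : (∫ t in t₁..t₂, ∫ x in (a₀ + a₁ * t)..(b₀ + b₁ * t), d (t, x)) ≤ 0 :=
    intervalIntegral_nonpos_of_le ht fun t ht' =>
      intervalIntegral_nonpos_of_le (hαβ t ht') fun x hx => hneg t ht' x hx
  linarith

/-- **Monotonicity between fixed ends.** Under the hypotheses of `trapezoid_identity`, if
`t₁ ≤ t₂`, `0 ≤ L`, the source is non-positive on `[t₁, t₂] × [−L, L]` and the fluxes through the
two ends agree (`g(t, L) = g(t, −L)`, e.g. both vanish), then
`∫_{−L}^{L} q(t₂,·) ≤ ∫_{−L}^{L} q(t₁,·)`. [folklore] -/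
theorem integral_rect_le {q g d : ℝ × ℝ → ℝ} (hq : Differentiable ℝ q) (hg : Differentiable ℝ g)
    (hd : Continuous d) (hdiv : ∀ z, fderiv ℝ q z (1, 0) + fderiv ℝ g z (0, 1) = d z)
    {L t₁ t₂ : ℝ} (hL : 0 ≤ L) (ht : t₁ ≤ t₂)
    (hneg : ∀ t ∈ Icc t₁ t₂, ∀ x ∈ Icc (-L) L, d (t, x) ≤ 0)
    (hflux : ∀ t ∈ Icc t₁ t₂, g (t, L) = g (t, -L)) :
    (∫ x in (-L)..L, q (t₂, x)) ≤ ∫ x in (-L)..L, q (t₁, x) := by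
  have key := trapezoid_le hq hg hd hdiv (-L) 0 L 0 ht
    (fun t _ => by linarith) (fun t ht' x hx => hneg t ht' x (by simpa using hx))
  simp only [zero_mul, add_zero] at key
  have h0 : (∫ t in t₁..t₂, (0 - g (t, L) - (0 - g (t, -L)))) = 0 := by
    rw [intervalIntegral.integral_congr (g := fun _ => (0 : ℝ)) (fun t ht' => ?_)]
    · simp
    · rw [uIcc_of_le ht] at ht'
      simp only [hflux t ht']
      ring
  linarith

end MovingWells

end

end Summit.FinalStateConjecture.FinalStateConjecture.Theorems
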